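import Mathlib

/-!
# Route `SquareRootCeilings`, crux `SqrtDomination` (stmt-QuantumFields-26902): the Wick-square instance

The home model of K2 (`SqrtDomination`, uniform-envelope form) is a Gaussian lattice field `φ` (e.g. the lattice
GFF₄ restricted to `n` sites) with covariance `S i j`, and the composite fields `Yᵢ = :φᵢ²: = φᵢ² − Sᵢᵢ`.  Isserlis'
theorem gives the DICTIONARY [folklore: Isserlis 1918; Simon, *The P(φ)₂ Euclidean QFT* §I.3; Glimm–Jaffe §6.3]
  `E ∏ᵢ Yᵢ = Σ_{σ derangement of [n]} 2^{n − #cycles(σ)} ∏ᵢ S i (σ i)`   and   `Cov(Yᵢ, Yⱼ) = 2 (S i j)²`,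
so K2's hypothesis "one envelope `b` bounds every two-point function" reads `2 (S i j)² ≤ b` (`i ≠ j`), and K2's
conclusion `|E ∏ᵢ Yᵢ| ≤ (C n^θ √b)ⁿ` becomes a statement about the derangement sum alone.  This file takes the
right-hand side of Isserlis' formula as the DEFINITION `wickSquareMoment` and proves K2 for it with `C = 2`,
`θ = 1`: `|wickSquareMoment n S| ≤ n! (2√b)ⁿ ≤ (2 n √b)ⁿ` — ORDER FROM SIZE with the square-root gain, by nothing
more than `|S i (σ i)| ≤ √b` edge by edge and `#derangements ≤ n! ≤ nⁿ`.  Together with the matrix-valued cycle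
bound `gaussianCycleRung` (vector-valued fields) this is the model in which the crux is DECIDED; nothing about
Yang–Mills, the leaf, a leg or the summit is asserted or proved here.
-/

set_option autoImplicit false

namespace Summit.QuantumFields.YangMills.Cruxes.SqrtDomination.Rung

open Finset

/-- The Wick-square `n`-point moment of a centred Gaussian vector with covariance `S`, in Isserlis' closed form
(taken as the definition): `Σ_{σ derangement} 2^{n − #cycles σ} ∏ᵢ S i (σ i)`.  (The envelope hypothesis
`2 (S i j)² ≤ b` below already forces `0 ≤ b` when `n ≥ 2`; no separate sign hypothesis is needed.) -/
noncomputable def wickSquareMoment (n : ℕ) (S : Fin n → Fin n → ℝ) : ℝ :=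
  ∑ σ : Equiv.Perm (Fin n),
    if (∀ i, σ i ≠ i) then (2 : ℝ) ^ (n - Multiset.card σ.cycleType) * ∏ i, S i (σ i) else 0

/-- `n! ≤ nⁿ`. -/
theorem factorial_le_pow_self (n : ℕ) : n.factorial ≤ n ^ n := by
  induction n with
  | zero => simp
  | succ k ih =>
    rw [Nat.factorial_succ, pow_succ']
    exact Nat.mul_le_mul_left _ (ih.trans (Nat.pow_le_pow_left (Nat.le_succ k) k))

/-- Edge bound: the envelope hypothesis `2 (S i j)² ≤ b` gives `|S i j| ≤ √b`. -/
theorem abs_le_sqrt_of_two_mul_sq_le {x b : ℝ} (h : 2 * x ^ 2 ≤ b) : |x| ≤ Real.sqrt b := by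
  have hx : x ^ 2 ≤ b := by nlinarith [sq_nonneg x]
  calc |x| = Real.sqrt (x ^ 2) := (Real.sqrt_sq_eq_abs x).symm
    _ ≤ Real.sqrt b := Real.sqrt_le_sqrt hx

/-- One derangement term is at most `(2√b)ⁿ`. -/
theorem abs_term_le (n : ℕ) (S : Fin n → Fin n → ℝ) {b : ℝ}
    (hS : ∀ i j : Fin n, i ≠ j → 2 * (S i j) ^ 2 ≤ b) (σ : Equiv.Perm (Fin n)) :
    |(if (∀ i, σ i ≠ i) then (2 : ℝ) ^ (n - Multiset.card σ.cycleType) * ∏ i, S i (σ i) else 0)|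
      ≤ (2 * Real.sqrt b) ^ n := by
  split_ifs with hσ
  · rw [abs_mul, abs_pow, abs_two, Finset.abs_prod, mul_pow]
    have h2 : (2 : ℝ) ^ (n - Multiset.card σ.cycleType) ≤ 2 ^ n :=
      pow_le_pow_right₀ (by norm_num) (Nat.sub_le _ _)
    have hprod : ∏ i, |S i (σ i)| ≤ Real.sqrt b ^ n := by
      calc ∏ i, |S i (σ i)| ≤ ∏ _i : Fin n, Real.sqrt b :=
            Finset.prod_le_prod (fun i _ => abs_nonneg _)
              (fun i _ => abs_le_sqrt_of_two_mul_sq_le (hS i (σ i) (fun h => hσ i h.symm)))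
        _ = Real.sqrt b ^ n := by simp
    exact mul_le_mul h2 hprod (Finset.prod_nonneg fun i _ => abs_nonneg _) (pow_nonneg (by norm_num) _)
  · simp only [abs_zero]
    positivity

/-- **K2 in the Wick-square model, factorial form.** `|wickSquareMoment n S| ≤ n! · (2√b)ⁿ` under the uniform
two-point envelope `2 (S i j)² ≤ b` (`i ≠ j`). -/
theorem abs_wickSquareMoment_le_factorial (n : ℕ) (S : Fin n → Fin n → ℝ) {b : ℝ}
    (hS : ∀ i j : Fin n, i ≠ j → 2 * (S i j) ^ 2 ≤ b) :
    |wickSquareMoment n S| ≤ (n.factorial : ℝ) * (2 * Real.sqrt b) ^ n := by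
  unfold wickSquareMoment
  calc |∑ σ : Equiv.Perm (Fin n), (if (∀ i, σ i ≠ i) then
          (2 : ℝ) ^ (n - Multiset.card σ.cycleType) * ∏ i, S i (σ i) else 0)|
        ≤ ∑ σ : Equiv.Perm (Fin n), |(if (∀ i, σ i ≠ i) then
          (2 : ℝ) ^ (n - Multiset.card σ.cycleType) * ∏ i, S i (σ i) else 0)| :=
          Finset.abs_sum_le_sum_abs _ _
    _ ≤ ∑ _σ : Equiv.Perm (Fin n), (2 * Real.sqrt b) ^ n :=
          Finset.sum_le_sum fun σ _ => abs_term_le n S hS σ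
    _ = (n.factorial : ℝ) * (2 * Real.sqrt b) ^ n := by
          simp [Finset.sum_const, Finset.card_univ, Fintype.card_perm, Fintype.card_fin]

/-- **K2 in the Wick-square model, in the crux's shape** `(C n^θ √b)ⁿ` with `C = 2`, `θ = 1`:
`|wickSquareMoment n S| ≤ (2 n √b)ⁿ`. -/
theorem wickSquareRung (n : ℕ) (S : Fin n → Fin n → ℝ) {b : ℝ}
    (hS : ∀ i j : Fin n, i ≠ j → 2 * (S i j) ^ 2 ≤ b) :
    |wickSquareMoment n S| ≤ (2 * (n : ℝ) * Real.sqrt b) ^ n := by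
  have h1 := abs_wickSquareMoment_le_factorial n S hS
  have hfac : (n.factorial : ℝ) ≤ (n : ℝ) ^ n := by exact_mod_cast factorial_le_pow_self n
  calc |wickSquareMoment n S| ≤ (n.factorial : ℝ) * (2 * Real.sqrt b) ^ n := h1
    _ ≤ (n : ℝ) ^ n * (2 * Real.sqrt b) ^ n :=
        mul_le_mul_of_nonneg_right hfac (pow_nonneg (by positivity) _)
    _ = (2 * (n : ℝ) * Real.sqrt b) ^ n := by rw [← mul_pow]; ring

end Summit.QuantumFields.YangMills.Cruxes.SqrtDomination.Rung
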